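import Summits.HodgeConjecture.HodgeConjecture.Theses.PadicSemiregularLift
import Summits.HodgeConjecture.HodgeConjecture.Theorems.PadicSemiregularLiftFermatAnchorAssemblyDefs
import Summits.HodgeConjecture.HodgeConjecture.Theorems.PadicSemiregularLiftFermatAnchorAssemblyStubTransferLeaf
import Summits.HodgeConjecture.HodgeConjecture.Theorems.FermatAnchorAssembly.Negative.StubZeroOneSeedsAnchoredSuffice
import Literature.AlgebraicGeometry.Motives.JacobianDimensionBettiProofs

/-!
# Crux `FermatAnchorAssembly` (stmt-HodgeConjecture-14874) — line `Sketch` (parallelizable-avatar): SKELETON, gen 9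

Route `PadicSemiregularLift` of `HodgeConjecture`. The crux is
`FermatAnchorAssembly := PadicPridhamSemiregularity → FormalLiftingFromClassLifting →
FormalVectorBundlesAlgebraize → HodgeFermatVarieties` (P1b → P1a → P3a → HC for every complex Fermat
hypersurface `Xⁿₘ`).

The line (ideator 1, `Ideas/parallelizable-avatar.md`; leads `prover-line-stmt-HodgeConjecture-14874-0` gen 1–4,
continuation leads `…-c1-0` gen 5–6, `…-c2-0` gen 7, `…-c3-0` gen 8, `…-c4-0` gen 9): by the typing of P1a (`d ≤ 3 ∨ Ω¹ free`) the engine composes in dimension `≥ 4`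
only on abelian `W`-schemes, so the Fermat arm runs on the CM hosts of Fermat type — the powers `J(Cₘ)ᴺ⁺¹` of the
Jacobian of the Fermat curve `Cₘ = X¹ₘ` — reached from `Xⁿₘ` by Shioda–Katsura domination + Abel–Jacobi (`transfer`,
landed in conditional form over the LEAF print facts, `stub_transfer_of_leaf_facts`,
`Theorems/PadicSemiregularLiftFermatAnchorAssemblyStubTransferLeaf.lean`), and at ONE genuine, spanning supersingular
`p`-adic anchor of such a host (prime `p ≡ -1 (m)`, superspecial reduction `E^g`) the route's engine is run BY NAME
(landed glue `FermatAnchorAssemblyNegative.hodgeFermatJacobianPowersAt_of_exists_anchored`, p102534; vocabulary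
`Theorems/PadicSemiregularLiftFermatAnchorAssemblyDefs.lean`, p96559): h1b turns `{0,1}`-semiregular seeds into
(⋆)-seeds, Bloch–Esnault–Kerz + h1a give formal lifts, h3a algebraizes, Berthelot–Ogus puts the class in the `K`-span of
algebraic classes of the generic fibre, genuineness + spanning of the anchor descend to the complex host.

GEN 9 (lead c4, 2026-08-17): the leaf fact `Motives.two_mul_dim_eq_finrank_bettiCohomology` has LANDED
(`two_mul_dim_eq_finrank_bettiCohomology_holds`, `Literature/AlgebraicGeometry/Motives/JacobianDimensionBettiProofs.lean`,
Weil's construction `curveGenus_le_jacobian_dim`), so gen-8's `stub_jacobianDim` is DISCHARGED (theorem `jacobianDim` below)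
and the registered stub set is the remaining FOUR: `stub_fermatToCurvePowersSum`, `stub_jacobianPointed`, `stub_anchors`,
`stub_anchoredSeeds`. The line's status is unchanged (`Lines/Sketch-dead.md`, lead c3; `Lines/Sketch.dead.md`, lead c4):
construction-dead at `stub_anchors`, crux-hard at `stub_anchoredSeeds`; the skeleton is kept registered as the record of
what the composition consumes.

Registered stubs of gen 8 (text of lead c3 kept verbatim below), gen 8 = the gen-6/7 stub set UNCHANGED (gen 7 re-imported the landed leaf transfer
`stub_transfer_of_leaf_facts`, p127549; gen 8, lead c3, re-registers the same five statements under the continuation seat and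
records the closability audit: none of the three leaf facts has a `_holds` as of 2026-08-16T22:40Z; `stub_anchors` needs a TERM
of `Anchor _ (𝒥.J.powSucc N).X` for an abstract `𝒥 : Jacobian C`, i.e. a smooth proper `W(k)`-model of an abstract complex
abelian variety plus a value of the hypothesis structure `CrystallineRealization p k` — neither is constructible in the tree,
by design of `Motives/CrystallineRealization` and `Crystalline/PadicAnchorDefs` §Design) — wave-1 verdicts of lead c1 in brackets:
* `stub_fermatToCurvePowersSum : FermatHodgeClassesLiftToCurvePowersSum` — [ShiodaKatsura1979 §1 Thm 1.7 +
  Shioda1979HodgeFermat Thm I] Hodge classes of `Xⁿₘ` are finite sums of images of Hodge classes of the hosts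
  `Cₘ^{n−2j}` (Literature named fact). [stub-blocked on itself: the tree reduces it to the blow-up GEOMETRY of
  Shioda–Katsura's diagram (1.25) as smooth projective ℂ-schemes, `FermatHodgeClassesLiftToCurvePowersSum_of_blowupGeometry₃`,
  Deligne's Gysin input discharged; `2p ≠ n` and `n = 2` proved; residual `n = 2p ≥ 4`, all `m` — XL construction.]
* `stub_jacobianDim : Motives.two_mul_dim_eq_finrank_bettiCohomology` — [Milne 1986 Prop 2.1] `2 dim J(C) = b₁(C(ℂ))`
  (Literature named fact, LEAF). NEW in gen 6: replaces gen 5's `stub_curveToJacobianPowers :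
  CurvePowerHodgeClassesLiftToJacobianPowers`, which the tree derives from it in one line
  (`CurvePowerHodgeClassesLiftToJacobianPowers_of_two_mul_dim_eq`, HodgeTheory/AbelJacobiPullbackHodgeSection).
  [stub-blocked on itself; residual = `genus C ≤ dim J`, i.e. Weil's construction with `f^{(g)}` birational.]
* `stub_jacobianPointed : Motives.nonempty_jacobian_of_algPoints` — [Milne 1986 Thm 1.1, pointed case] a smooth
  projective curve with a rational point has a Jacobian (Literature named fact, LEAF, child 1 of
  `Motives/JacobianExistenceSplit`). NEW in gen 6: replaces gen 5's all-fields `stub_jacobianExists :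
  nonempty_jacobian_of_isSmoothProjective` — complex curves have points, so the Galois-descent child is not needed.
  [stub-blocked on itself; residual = the same Weil construction.]
* `stub_anchors` — every power of a Fermat Jacobian has a GENUINE, SPANNING supersingular anchor
  (`HasGenuineSpanningAnchor`); print-grade (disprover Finding 4(c)). [stub-blocked: no VALUE of
  `Motives.CrystallineRealization` exists or is buildable (definition item `defn-CrystallineRealization` closed under
  option (b) "hypothesis structure"; no W(k)-model of any abelian variety in the tree); content = the typed Fermat half
  (B1/B2 at Jacobian powers) of the route's informal support item stmt-HodgeConjecture-13944 `AnchorsAtGenericHodgeLocusPoints`.]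
* `stub_anchoredSeeds` — OPEN, the crux content (the lead's): given a genuine spanning anchor of a host, SOME genuine
  spanning anchor of it carries `{0,1}`-seeds (`ZeroOneSeedsFor`). ∃-anchored form recommended by the disprover
  (Finding 4(a)). [lead: ≥ HC-middle of every `J(C_m)^{N+1}` by the landed tightness
  `FermatAnchorAssemblyNegative.middleCyclePart_of_zeroOneSeedsFor`; not formalizable today (no realization value, no
  computation on `IsZeroOneSemiregular`); memo `STRUCTURE-c1-stub_anchoredSeeds.md` attached as evidence; lead c2
  (`Lines/Sketch-structure-c2.md`): granted the engine the stub at a host `X` is EQUIVALENT to the char-0 statement SRB(X)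
  — the exotic Hodge classes of the complex CM host are `ℚ`-combinations of `ch_r` of `{0,1}`-semiregular VECTOR BUNDLES on
  `X_ℂ` (seeds lift by the engine and injectivity of `(σ₀,σ₁)` generises over `W`; conversely such bundles spread out and reduce
  to seeds at almost all anchor primes); open at its first exotic instance (Weil classes of `B × E ⊂ J(C₇)`, HC known there).]

Composition `FermatAnchorAssembly_of` is kernel-checked modulo the stubs; h1b, h1a, h3a are all consumed. The card's ZERO-SEED
FALLBACK (the crux from `AbelianAnchorAssembly` + `HodgeLocusPropagation`, or from `HodgeAbelianVarieties`, modulo the same three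
leaf facts) is landed separately as `Theorems/PadicSemiregularLiftFermatAnchorAssemblyZeroSeedFallback.lean` (lead c2).
-/

set_option linter.dupNamespace false

noncomputable section

open CategoryTheory AlgebraicGeometry
open scoped Isocrystal
open Literature.AlgebraicGeometry Literature.AlgebraicGeometry.Motives
  Literature.AlgebraicGeometry.HodgeTheory Literature.AlgebraicGeometry.Crystalline
  Literature.AlgebraicGeometry.Crystalline.PadicAnchor Literature.AlgebraicGeometry.KTheory
open Summit.HodgeConjecture.HodgeConjecture.Theses.PadicSemiregularLift
open Summit.HodgeConjecture.HodgeConjecture.Theorems.FermatAnchorAssemblyNegative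
open Literature.AlgebraicTopology.SingularHomology

namespace Summit.HodgeConjecture.HodgeConjecture.Cruxes.FermatAnchorAssembly.ParallelizableAvatar

/-! ## Registered stubs -/

/-- STUB (print; Shioda–Katsura 1979 §1 Thm 1.7, Shioda 1979 Thm I): Hodge classes of the Fermat
hypersurface are finite sums of images of Hodge classes of powers of the Fermat curve (multi-host form). [folklore] -/
theorem stub_fermatToCurvePowersSum : Literature.AlgebraicGeometry.HodgeTheory.FermatHodgeClassesLiftToCurvePowersSum := by
  sorry

/-- DISCHARGED in gen 9 (was `stub_jacobianDim`, gens 6–8): `2 · dim J(C) = b₁(C(ℂ))` for every Jacobian of a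
smooth projective complex curve — the Literature leaf fact now holds (`two_mul_dim_eq_finrank_bettiCohomology_holds`,
Milne 1986 Prop 2.1 via Weil's construction). [cite: Milne1986JacobianVarieties, §2 Prop. 2.1] -/
theorem jacobianDim : Literature.AlgebraicGeometry.Motives.two_mul_dim_eq_finrank_bettiCohomology :=
  Literature.AlgebraicGeometry.Motives.two_mul_dim_eq_finrank_bettiCohomology_holds

/-- STUB (print; Milne 1986 Thm 1.1 pointed case, existing Literature LEAF fact): a smooth projective
curve with a rational point has a Jacobian. [folklore] -/
theorem stub_jacobianPointed : Literature.AlgebraicGeometry.Motives.nonempty_jacobian_of_algPoints.{0} := by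
  sorry

/-- STUB (print; CM theory + Shioda–Katsura supersingular primes + the classical `p`-adic package):
genuine spanning anchors of the Fermat-Jacobian powers exist. [folklore] -/
theorem stub_anchors : ∀ (m : ℕ) (C : SchemeOver ℂ) (𝒥 : Jacobian C), IsFermatVariety 1 m C → IsSmoothProjective 1 C → ∀ N : ℕ, HasGenuineSpanningAnchor (𝒥.J.powSucc N).dim (𝒥.J.powSucc N).X := by
  sorry

/-- STUB (OPEN — the crux content; hardest, the lead's): at the hosts, some genuine spanning anchor
carries `{0,1}`-semiregular Hodge-clean seeds. [folklore] -/
theorem stub_anchoredSeeds : ∀ (m : ℕ) (C : SchemeOver ℂ) (𝒥 : Jacobian C), IsFermatVariety 1 m C → IsSmoothProjective 1 C → ∀ N : ℕ, HasGenuineSpanningAnchor (𝒥.J.powSucc N).dim (𝒥.J.powSucc N).X → ∃ D : Anchor (𝒥.J.powSucc N).dim (𝒥.J.powSucc N).X, D.IsGenuine ∧ D.SpansHodge ∧ ZeroOneSeedsFor D.C (𝒥.J.powSucc N).dim D.𝒴 := by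
  sorry

/-! ## Composition (sorry-free) -/

/-- The gen-2 transfer stub, a theorem modulo the three LEAF print stubs: the landed
`stub_transfer_of_leaf_facts` (`Theorems/PadicSemiregularLiftFermatAnchorAssemblyStubTransferLeaf.lean`, p127549) fed with
`stub_fermatToCurvePowersSum`, `jacobianDim` (landed, gen 9), `stub_jacobianPointed`. [folklore] -/
theorem transfer :
    (∀ (m : ℕ) (C : SchemeOver ℂ) (𝒥 : Jacobian C), HodgeFermatJacobianPowersAt m C 𝒥) →
      HodgeFermatVarieties :=
  stub_transfer_of_leaf_facts stub_fermatToCurvePowersSum jacobianDim stub_jacobianPointed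

/-- Anchored seeds at every host, from `stub_anchors` + `stub_anchoredSeeds`. [folklore] -/
theorem anchoredSeeds :
    ∀ (m : ℕ) (C : SchemeOver ℂ) (𝒥 : Jacobian C), IsFermatVariety 1 m C → IsSmoothProjective 1 C →
      ∀ N : ℕ, ∃ D : Anchor (𝒥.J.powSucc N).dim (𝒥.J.powSucc N).X,
        D.IsGenuine ∧ D.SpansHodge ∧ ZeroOneSeedsFor D.C (𝒥.J.powSucc N).dim D.𝒴 :=
  fun m C 𝒥 hF hC N => stub_anchoredSeeds m C 𝒥 hF hC N (stub_anchors m C 𝒥 hF hC N)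

/-- **The line closes the crux modulo its stubs**: transfer ∘ (engine at one anchored host per power of
a Fermat Jacobian). [folklore] -/
theorem FermatAnchorAssembly_of : FermatAnchorAssembly :=
  fun h1b h1a h3a =>
    transfer (hodgeFermatJacobianPowersAt_of_exists_anchored h1b h1a h3a anchoredSeeds)

end Summit.HodgeConjecture.HodgeConjecture.Cruxes.FermatAnchorAssembly.ParallelizableAvatar

end
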